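import Summits.ValiantsHypothesis.ValiantsHypothesis.Theorems.MonotoneRestorationOrbitRestorationQPSignCount
import Summits.ValiantsHypothesis.ValiantsHypothesis.Theorems.MonotoneRestorationOrbitRestorationQPLocalFactors
import HarnessLib

/-!
# The sign of an involutive algebra automorphism on a product of lines; row/column transport of factors
# (ORBIT currency, ΠΣ sub-rung)

Route MonotoneRestoration, crux `OrbitRestorationQP` (stmt-ValiantsHypothesis-18293), line `depth-three-rung`,
stub A₁ `stub_piSigmaValue`, namespace `Summit.ValiantsHypothesis.ValiantsHypothesis.Theorems.ActionSignCount`.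

The parity proof of rule M2′ (evidence `A1-M2PRIME-PROOF.md` on the crux item, §0 (γ) and §3 (iv)) applies the sign
count of `SignCount.prod_map_ren_eq_neg_one_pow_mul` not only to the diagonal action `ren` but to the PURE ROW and PURE
COLUMN transpositions `vact rowHom (x y)`, `vact colHom (x y)`.  This file provides that generality (item L1 of the plan):

* `prod_map_eq_neg_one_pow_mul`, `act_prod_eq_self_iff_even` — for ANY involutive `ℂ`-algebra automorphism `θ` of
  `ℂ[x_ij]` and a multiset `A` of nonzero polynomials with `θ·A`, `A` of the same associates:
  `Π(θ·A) = (-1)^N ΠA`, `N = #{ℓ ∈ A : θℓ = -ℓ}`, and `θ` fixes `ΠA` iff `N` is even;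
* `map_mk_map_vact_eq` — unique factorisation for a position action `vact g`: if `f = a·ΠL ≠ 0` (degree-one
  factors) is `vact g`-invariant then `L` and `vact g σ · L` have the same associates (the `vact` twin of
  `SupportBlocks.map_mk_map_ren_eq`);
* `even_card_filter_vact_neg` — hence, for `f` invariant under `vact g`, every involution `vact g τ` (`τ² = 1`)
  negates an EVEN number of members of `L` ("`E_ρ`, `E_κ` are even").

Everything is proved. [folklore]

## References
* A. Dawar, G. Wilsenach, *Symmetric arithmetic circuits*, ToC 21 (2025), §3.3, Def. 6.1. [DawarWilsenach2025]
-/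

noncomputable section

open scoped Classical

-- `Summit.ValiantsHypothesis.ValiantsHypothesis.…` is the tree's single-conjunct layout (Sub = Summit).
set_option linter.dupNamespace false

namespace Summit.ValiantsHypothesis.ValiantsHypothesis.Theorems

namespace ActionSignCount

open Equiv ProductAction

variable {n : ℕ}

/-- An algebra automorphism fixes constants. [folklore] -/
theorem aut_C (θ : MvPolynomial (Fin n × Fin n) ℂ ≃ₐ[ℂ] MvPolynomial (Fin n × Fin n) ℂ) (u : ℂ) : θ (MvPolynomial.C u) = MvPolynomial.C u := by
  rw [← MvPolynomial.algebraMap_eq]; exact θ.commutes u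

/-- Transport of negation along an exchanged pair, for an automorphism: if `θ ℓ = u ℓ'`, `θ ℓ' = u⁻¹ ℓ` and
`θ ℓ = -ℓ`, then `θ ℓ' = -ℓ'`. [folklore] -/
theorem act_eq_neg_of_partner (θ : MvPolynomial (Fin n × Fin n) ℂ ≃ₐ[ℂ] MvPolynomial (Fin n × Fin n) ℂ) {ℓ ℓ' : MvPolynomial (Fin n × Fin n) ℂ} {u : ℂ} (hu0 : u ≠ 0)
    (hu : θ ℓ = MvPolynomial.C u * ℓ') (hu' : θ ℓ' = MvPolynomial.C u⁻¹ * ℓ) (hneg : θ ℓ = -ℓ) :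
    θ ℓ' = -ℓ' := by
  have h1 : ℓ' = MvPolynomial.C u⁻¹ * (-ℓ) := by
    calc ℓ' = MvPolynomial.C (u⁻¹ * u) * ℓ' := by rw [inv_mul_cancel₀ hu0, map_one, one_mul]
      _ = MvPolynomial.C u⁻¹ * (MvPolynomial.C u * ℓ') := by rw [map_mul, mul_assoc]
      _ = MvPolynomial.C u⁻¹ * (-ℓ) := by rw [← hu, hneg]
  rw [hu', h1]
  ring

/-- **THE SIGN OF AN INVOLUTIVE AUTOMORPHISM ON A PRODUCT OF LINES.**  Let `θ` be an involutive `ℂ`-algebra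
automorphism of `ℂ[x_ij]` and `A` a multiset of nonzero polynomials such that `θ · A` and `A` have the same associates.
Then `Π (θ · A) = (-1)^N · Π A` where `N` is the number of members of `A` negated by `θ`. [folklore] -/
theorem prod_map_eq_neg_one_pow_mul (θ : MvPolynomial (Fin n × Fin n) ℂ ≃ₐ[ℂ] MvPolynomial (Fin n × Fin n) ℂ) (hθ : ∀ p, θ (θ p) = p) :
    ∀ (A : Multiset (MvPolynomial (Fin n × Fin n) ℂ)), (∀ ℓ ∈ A, ℓ ≠ 0) →
      (A.map θ).map Associates.mk = A.map Associates.mk →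
      (A.map θ).prod = (-1) ^ Multiset.card (A.filter fun ℓ => θ ℓ = -ℓ) * A.prod := by
  intro A
  induction h : Multiset.card A using Nat.strong_induction_on generalizing A with
  | _ N ih =>
    intro hA0 hmk
    rcases Multiset.empty_or_exists_mem A with rfl | ⟨ℓ, hℓ⟩
    · simp
    · have hmem : Associates.mk (θ ℓ) ∈ A.map Associates.mk := by
        rw [← hmk]; exact Multiset.mem_map.2 ⟨θ ℓ, Multiset.mem_map.2 ⟨ℓ, hℓ, rfl⟩, rfl⟩
      obtain ⟨ℓ', hℓ', hℓ'eq⟩ := Multiset.mem_map.1 hmem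
      obtain ⟨u, hu0, hu⟩ := SupportBlocks.exists_C_of_associated (Associates.mk_eq_mk_iff_associated.1 hℓ'eq)
      have hℓ0 : ℓ ≠ 0 := hA0 ℓ hℓ
      obtain ⟨A', rfl⟩ := Multiset.exists_cons_of_mem hℓ
      by_cases hfix : ℓ' = ℓ
      · -- fixed line: `u = ±1`
        rw [hfix] at hu
        have huu : u * u = 1 := by
          have h1 := congrArg θ hu
          rw [hθ, map_mul, aut_C, hu, ← mul_assoc, ← map_mul] at h1
          have h2 : MvPolynomial.C (u * u) * ℓ = MvPolynomial.C 1 * ℓ := by rw [map_one, one_mul]; exact h1.symm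
          exact MvPolynomial.C_injective _ _ (mul_right_cancel₀ hℓ0 h2)
        have e0 : Associates.mk (MvPolynomial.C u * ℓ) = Associates.mk ℓ :=
          Associates.mk_eq_mk_iff_associated.2
            (associated_unit_mul_left _ _ ((isUnit_iff_ne_zero.2 hu0).map MvPolynomial.C))
        have hmk' : (A'.map θ).map Associates.mk = A'.map Associates.mk := by
          rw [Multiset.map_cons, Multiset.map_cons, Multiset.map_cons, hu, e0] at hmk
          exact (Multiset.cons_inj_right _).1 hmk
        have hIH := ih (Multiset.card A') (by rw [← h, Multiset.card_cons]; exact Nat.lt_succ_self _) A' rfl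
          (fun x hx => hA0 x (Multiset.mem_cons_of_mem hx)) hmk'
        rcases mul_self_eq_one_iff.1 huu with rfl | rfl
        · rw [map_one, one_mul] at hu
          have hnot : ¬θ ℓ = -ℓ := by rw [hu]; exact SignCount.ne_neg_self hℓ0
          rw [Multiset.filter_cons_of_neg (p := fun q => θ q = -q) _ hnot, Multiset.map_cons, Multiset.prod_cons,
            Multiset.prod_cons, hu, hIH]
          ring
        · have hyes : θ ℓ = -ℓ := by rw [hu, map_neg, map_one]; ring
          rw [Multiset.filter_cons_of_pos (p := fun q => θ q = -q) _ hyes, Multiset.card_cons, Multiset.map_cons,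
            Multiset.prod_cons, Multiset.prod_cons, hyes, hIH, pow_succ]
          ring
      · -- exchanged pair
        have hℓ'A' : ℓ' ∈ A' := (Multiset.mem_cons.1 hℓ').resolve_left hfix
        obtain ⟨A'', rfl⟩ := Multiset.exists_cons_of_mem hℓ'A'
        have hu' : θ ℓ' = MvPolynomial.C u⁻¹ * ℓ := by
          have h1 := congrArg θ hu
          rw [hθ, map_mul, aut_C] at h1
          rw [h1, ← mul_assoc, ← map_mul, inv_mul_cancel₀ hu0, map_one, one_mul]
        have e1 : Associates.mk (MvPolynomial.C u * ℓ') = Associates.mk ℓ' :=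
          Associates.mk_eq_mk_iff_associated.2
            (associated_unit_mul_left _ _ ((isUnit_iff_ne_zero.2 hu0).map MvPolynomial.C))
        have e2 : Associates.mk (MvPolynomial.C u⁻¹ * ℓ) = Associates.mk ℓ :=
          Associates.mk_eq_mk_iff_associated.2
            (associated_unit_mul_left _ _ ((isUnit_iff_ne_zero.2 (inv_ne_zero hu0)).map MvPolynomial.C))
        have hmk'' : (A''.map θ).map Associates.mk = A''.map Associates.mk := by
          have h3 : Associates.mk ℓ' ::ₘ Associates.mk ℓ ::ₘ (A''.map θ).map Associates.mk =
              Associates.mk ℓ ::ₘ Associates.mk ℓ' ::ₘ A''.map Associates.mk := by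
            have h4 := hmk
            rw [Multiset.map_cons, Multiset.map_cons, Multiset.map_cons, Multiset.map_cons, Multiset.map_cons,
              Multiset.map_cons, hu, hu', e1, e2] at h4
            exact h4
          rw [Multiset.cons_swap] at h3
          exact (Multiset.cons_inj_right _).1 ((Multiset.cons_inj_right _).1 h3)
        have hcard : Multiset.card A'' < N := by
          rw [← h, Multiset.card_cons, Multiset.card_cons]; omega
        have hIH := ih _ hcard A'' rfl (fun x hx => hA0 x (Multiset.mem_cons_of_mem (Multiset.mem_cons_of_mem hx)))
          hmk''
        have hscal : MvPolynomial.C u * ℓ' * (MvPolynomial.C u⁻¹ * ℓ) = ℓ * ℓ' := by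
          calc MvPolynomial.C u * ℓ' * (MvPolynomial.C u⁻¹ * ℓ)
              = MvPolynomial.C (u * u⁻¹) * (ℓ * ℓ') := by rw [map_mul]; ring
            _ = ℓ * ℓ' := by rw [mul_inv_cancel₀ hu0, map_one, one_mul]
        have hiff : θ ℓ = -ℓ ↔ θ ℓ' = -ℓ' := by
          constructor
          · exact act_eq_neg_of_partner θ hu0 hu hu'
          · intro hneg'
            have hu'' : θ ℓ = MvPolynomial.C u⁻¹⁻¹ * ℓ' := by rw [inv_inv]; exact hu
            exact act_eq_neg_of_partner θ (inv_ne_zero hu0) hu' hu'' hneg'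
        by_cases hneg : θ ℓ = -ℓ
        · rw [Multiset.filter_cons_of_pos (p := fun q => θ q = -q) _ hneg,
            Multiset.filter_cons_of_pos (p := fun q => θ q = -q) _ (hiff.1 hneg), Multiset.card_cons,
            Multiset.card_cons, Multiset.map_cons, Multiset.map_cons, Multiset.prod_cons, Multiset.prod_cons,
            Multiset.prod_cons, Multiset.prod_cons, hu, hu', hIH, ← mul_assoc, hscal, pow_succ, pow_succ]
          ring
        · rw [Multiset.filter_cons_of_neg (p := fun q => θ q = -q) _ hneg,
            Multiset.filter_cons_of_neg (p := fun q => θ q = -q) _ (fun h' => hneg (hiff.2 h')),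
            Multiset.map_cons, Multiset.map_cons, Multiset.prod_cons, Multiset.prod_cons, Multiset.prod_cons,
            Multiset.prod_cons, hu, hu', hIH, ← mul_assoc, hscal]
          ring

/-- **Parity form.**  Under the hypotheses of `prod_map_eq_neg_one_pow_mul`, the involution `θ` fixes `Π A` iff it
negates an even number of members of `A`. [folklore] -/
theorem act_prod_eq_self_iff_even (θ : MvPolynomial (Fin n × Fin n) ℂ ≃ₐ[ℂ] MvPolynomial (Fin n × Fin n) ℂ) (hθ : ∀ p, θ (θ p) = p)
    (A : Multiset (MvPolynomial (Fin n × Fin n) ℂ)) (hA0 : ∀ ℓ ∈ A, ℓ ≠ 0)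
    (hmk : (A.map θ).map Associates.mk = A.map Associates.mk) :
    θ A.prod = A.prod ↔ Even (Multiset.card (A.filter fun ℓ => θ ℓ = -ℓ)) := by
  have hprod : A.prod ≠ 0 := Multiset.prod_ne_zero fun h0 => hA0 0 h0 rfl
  rw [map_multiset_prod, prod_map_eq_neg_one_pow_mul θ hθ A hA0 hmk]
  constructor
  · intro h
    have h1 : ((-1 : MvPolynomial (Fin n × Fin n) ℂ) ^ Multiset.card (A.filter fun ℓ => θ ℓ = -ℓ) - 1) *
        A.prod = 0 := by rw [sub_mul, one_mul, h, sub_self]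
    have h2 := (mul_eq_zero.1 h1).resolve_right hprod
    rw [sub_eq_zero] at h2
    by_contra hodd
    rw [Nat.not_even_iff_odd] at hodd
    rw [hodd.neg_one_pow] at h2
    exact SignCount.ne_neg_self (n := n) one_ne_zero h2.symm
  · intro heven
    rw [heven.neg_one_pow, one_mul]

/-! ### Unique factorisation for a position action -/

/-- **A position action permutes the factors up to associates.**  If `f = a · Π L` (degree-one factors) is nonzero
and invariant under `vact g` then `L` and `vact g σ · L` have the same associates. [folklore] -/
theorem map_mk_map_vact_eq (g : Perm (Fin n) →* Perm (Fin n × Fin n))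
    {L : Multiset (MvPolynomial (Fin n × Fin n) ℂ)} {a : ℂ}
    (hL1 : ∀ ℓ ∈ L, ℓ.totalDegree = 1) (hf0 : MvPolynomial.C a * L.prod ≠ 0)
    (hfix : ∀ σ : Perm (Fin n), vact (K := ℂ) g σ (MvPolynomial.C a * L.prod) = MvPolynomial.C a * L.prod)
    (σ : Perm (Fin n)) : (L.map (vact (K := ℂ) g σ)).map Associates.mk = L.map Associates.mk := by
  have hirr : ∀ x ∈ L.map (vact (K := ℂ) g σ), Irreducible x := by
    intro x hx
    obtain ⟨ℓ, hℓ, rfl⟩ := Multiset.mem_map.1 hx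
    exact AffineFactors.irreducible_of_totalDegree_eq_one (by rw [LocalFactors.totalDegree_vact, hL1 ℓ hℓ])
  have hirr' : ∀ x ∈ L, Irreducible x := fun x hx => AffineFactors.irreducible_of_totalDegree_eq_one (hL1 x hx)
  have ha : (MvPolynomial.C a : MvPolynomial (Fin n × Fin n) ℂ) ≠ 0 := by
    intro h; exact hf0 (by rw [h, zero_mul])
  have hprod : (L.map (vact (K := ℂ) g σ)).prod = L.prod := by
    have h := hfix σ
    rw [map_mul, aut_C, map_multiset_prod] at h
    exact mul_left_cancel₀ ha h
  exact Associates.rel_associated_iff_map_eq_map.1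
    (UniqueFactorizationMonoid.factors_unique hirr hirr' (hprod ▸ Associated.refl _))

/-- **`E_θ` is even.**  If `f = a · Π L ≠ 0` (degree-one factors) is invariant under the position action `vact g`, then
every involution `vact g τ` (`τ * τ = 1`) negates an even number of members of `L`. [folklore] -/
theorem even_card_filter_vact_neg (g : Perm (Fin n) →* Perm (Fin n × Fin n))
    {L : Multiset (MvPolynomial (Fin n × Fin n) ℂ)} {a : ℂ}
    (hL1 : ∀ ℓ ∈ L, ℓ.totalDegree = 1) (hf0 : MvPolynomial.C a * L.prod ≠ 0)
    (hfix : ∀ σ : Perm (Fin n), vact (K := ℂ) g σ (MvPolynomial.C a * L.prod) = MvPolynomial.C a * L.prod)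
    {τ : Perm (Fin n)} (hτ : τ * τ = 1) :
    Even (Multiset.card (L.filter fun ℓ => vact (K := ℂ) g τ ℓ = -ℓ)) := by
  have ha : (MvPolynomial.C a : MvPolynomial (Fin n × Fin n) ℂ) ≠ 0 := by
    intro h; exact hf0 (by rw [h, zero_mul])
  have hθ : ∀ p, vact (K := ℂ) g τ (vact (K := ℂ) g τ p) = p := fun p => by
    rw [← AlgEquiv.mul_apply, ← map_mul, hτ, map_one, AlgEquiv.one_apply]
  have hprod : vact (K := ℂ) g τ L.prod = L.prod := by
    have h := hfix τ
    rw [map_mul, aut_C] at h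
    exact mul_left_cancel₀ ha h
  exact (act_prod_eq_self_iff_even (vact (K := ℂ) g τ) hθ L
    (fun ℓ hℓ => AffineFactors.ne_zero_of_mem hf0 hℓ) (map_mk_map_vact_eq g hL1 hf0 hfix τ)).1 hprod

end ActionSignCount

end Summit.ValiantsHypothesis.ValiantsHypothesis.Theorems

end
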